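import Literature.Computability.QuantumComplexity.SandwichApprox
import Literature.Computability.QuantumComplexity.OAAWord
import Literature.Computability.QuantumComplexity.ReversibleCliffordT
import HarnessLib

/-!
# Grover–Rudolph state preparation: the product of conditional rotations is the qsample

Topic `Literature/Computability/QuantumComplexity`. The state-vector content of Grover–Rudolph
(2002): to prepare the *qsample* `Σ_y √p(y) |y⟩` of a distribution `p` on `{0,1}^ℓ` whose prefix
masses `p(b) = Σ_{y ⊒ b} p(y)` are computable, rotate the qubits one at a time, most significant
first, the `j`-th qubit by the angle `θ` with `cos θ = √(p(b0)/p(b))`, `sin θ = √(p(b1)/p(b))`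
conditioned on the already prepared prefix `b` ("`|ψ_b⟩ ↦ √f(b) |0⟩ + √(1 − f(b)) |1⟩`", eq. (2)–(4)
of the paper); by induction on the level the register holds `Σ_{|b| = j} √p(b) |b 0^{ℓ-j}⟩` (eq. (5)).
This is the state-preparation step of Regev's quantum sampler (Regev 2009, Lemma 3.12: "this state can
be created efficiently using a technique by Grover and Rudolph").

In the tree's circuit model (`QReg N`, `basisState`, `l2Norm`, the label-controlled one-qubit gates
`ctrlGate t U` of `SandwichApprox.lean` — the ideal gates that the Clifford+`T` rotation gadgets
`rotGadget_implOn_gen` implement up to dyadic rounding) this file proves, for an arbitrary nonnegative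
weight `w` on `Fin ℓ → Bool` (normalisation `W = Σ w > 0`) placed on the wires of an embedding
`ws : Fin ℓ ↪ Fin N`:

* `GroverRudolph.prefW w j y` — the mass of the labels agreeing with `y` below `j` (`prefW_zero = W`,
  `prefW_of_le : j ≥ ℓ → prefW = w y`, the splitting `prefW_succ`, dependence on the prefix only);
* `GroverRudolph.rotBlock w j y` — the real rotation `[[c, −s], [s, c]]`, `c = √(p(b0)/p(b))`,
  `s = √(p(b1)/p(b))` (identity on massless prefixes), unitary (`rotBlock_mem_unitaryGroup`) and
  independent of the bits from `j` on; `GroverRudolph.levelGate w ws j = ctrlGate (ws j) (rotBlock w j (· ∘ ws))`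
  (unitary, preserves every support condition closed under rewriting the wire `ws j`);
* `GroverRudolph.stateAt w ws x j` — `Σ_{y clean from j on} √(prefW j y / W) |x[ws ↦ y]⟩` and the
  **level step** `levelGate_mulVec_stateAt`: level `j` maps `stateAt j` to `stateAt (j+1)`;
* **`GroverRudolph.prod_levelGate_mulVec_basisState`** — the ideal theorem: on a basis input clean on the
  wires `ws`, the levels `0, …, ℓ−1` produce the qsample `Σ_y √(w y / W) |x[ws ↦ y]⟩`, a unit vector
  (`l2Norm_qsample`);
* **`GroverRudolph.l2Norm_prod_sub_qsample_le`** — the robust form: if matrices `M j` implement the level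
  gates on a support condition `P` (closed under rewriting the wires `ws j`, containing `x`) up to `δ j`
  and are contractions, their product applied to `|x⟩` is within `Σ δ j` of the qsample
  (`ImplOn.listProd` of `ApproxImplementation.lean`);
* **`GroverRudolph.l2Norm_prod_genLevelGate_sub_qsample_le`** — the form the machines need, with
  PERTURBED blocks `R j y` (rounded angles): if on the *good* labels the first column of `R j y` is
  entrywise within `ε` of the exact rotation and the other clean level-`j` labels carry normalised mass
  `≤ β` (`sum_cleanFrom_prefW`: the level-`j` prefixes partition the mass), the product of the perturbed
  levels (`genLevelGate`) on `|x⟩` is within `ℓ·√(2ε² + 8β)` of the qsample — the one-level deviation is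
  the `p(b)/W`-weighted sum of squared entry deviations (`normSq_genLevelGate_sub_levelGate_stateAt`,
  orthogonality `normSq_sum_add_sum`), and the levels telescope against the exact evolution.

Everything here is proved; definitions have bodies; no named fact is introduced. The angles' classical
computation (prefix masses to dyadic precision) and the gadgets are assembled in the sequel files.

## References

* L. Grover, T. Rudolph, *Creating superpositions that correspond to efficiently integrable probability
  distributions*, arXiv:quant-ph/0208112 (2002), eqs. (2)–(5) [GroverRudolph2002].
* O. Regev, *On lattices, learning with errors, random linear codes, and cryptography*, J. ACM 56
  (2009), art. 34, Lemma 3.12 (proof) [Regev2009].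
* M. A. Nielsen, I. L. Chuang, *Quantum Computation and Quantum Information*, CUP 2010, §4.3
  (controlled operations), §4.5.3 (accumulation of errors) [NielsenChuang2010].
-/

noncomputable section

namespace Literature.Computability.QuantumComplexity

open _root_.Matrix Complex Finset Cryptography

namespace GroverRudolph

variable {N ℓ : ℕ}

/-! ### Prefix masses -/

section Prefix

variable (w : (Fin ℓ → Bool) → ℝ)

/-- Two leaf labels agree below level `j`. [folklore] -/
def AgreeBelow (j : ℕ) (y y' : Fin ℓ → Bool) : Prop := ∀ i : Fin ℓ, (i : ℕ) < j → y' i = y i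

/-- Agreement below a level is decidable. [folklore] -/
instance (j : ℕ) (y y' : Fin ℓ → Bool) : Decidable (AgreeBelow j y y') := by
  unfold AgreeBelow; infer_instance

/-- **The prefix mass**: the total weight of the labels agreeing with `y` below level `j` (Grover–Rudolph's
`p(b)` for the prefix `b = y↾j`). [cite: GroverRudolph2002, eq. (3)] -/
def prefW (j : ℕ) (y : Fin ℓ → Bool) : ℝ := ∑ y' ∈ univ.filter (fun y' => AgreeBelow j y y'), w y'

/-- The total mass `W = Σ w`. [folklore] -/
def total : ℝ := ∑ y, w y

/-- At level `0` the prefix mass is the total mass. [folklore] -/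
theorem prefW_zero (y : Fin ℓ → Bool) : prefW w 0 y = total w := by
  unfold prefW total
  refine Finset.sum_congr ?_ fun _ _ => rfl
  ext y'
  simp [AgreeBelow]

/-- From level `ℓ` on the prefix mass is the weight of the leaf. [folklore] -/
theorem prefW_of_le {j : ℕ} (hj : ℓ ≤ j) (y : Fin ℓ → Bool) : prefW w j y = w y := by
  unfold prefW
  have : univ.filter (fun y' => AgreeBelow j y y') = {y} := by
    ext y'
    simp only [mem_filter, mem_univ, true_and, mem_singleton, AgreeBelow]
    constructor
    · intro h; funext i; exact h i (lt_of_lt_of_le i.2 hj)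
    · rintro rfl i _; rfl
  rw [this, sum_singleton]

/-- The prefix mass depends only on the prefix. [folklore] -/
theorem prefW_congr {j : ℕ} {y y' : Fin ℓ → Bool} (h : AgreeBelow j y y') : prefW w j y' = prefW w j y := by
  unfold prefW
  congr 1
  ext z
  simp only [mem_filter, mem_univ, true_and, AgreeBelow]
  constructor
  · intro hz i hi; rw [hz i hi, h i hi]
  · intro hz i hi; rw [hz i hi, ← h i hi]

/-- Nonnegative weights have nonnegative prefix masses. [folklore] -/
theorem prefW_nonneg (hw : ∀ y, 0 ≤ w y) (j : ℕ) (y : Fin ℓ → Bool) : 0 ≤ prefW w j y :=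
  sum_nonneg fun y' _ => hw y'

/-- **Splitting a prefix by its next bit**: `p(b) = p(b0) + p(b1)`. [cite: GroverRudolph2002, eq. (3)] -/
theorem prefW_succ (j : Fin ℓ) (y : Fin ℓ → Bool) :
    prefW w j y = prefW w (j + 1) (Function.update y j false) + prefW w (j + 1) (Function.update y j true) := by
  unfold prefW
  rw [← sum_filter_add_sum_filter_not (univ.filter fun y' => AgreeBelow j y y') (fun y' => y' j = false)]
  congr 1
  · congr 1
    ext z
    simp only [mem_filter, mem_univ, true_and, AgreeBelow]
    constructor
    · rintro ⟨h1, h2⟩ i hi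
      rcases Nat.lt_succ_iff_lt_or_eq.1 hi with hi | hi
      · rw [Function.update_of_ne (Fin.ne_of_lt hi), h1 i hi]
      · have : i = j := Fin.ext hi
        subst this; rw [Function.update_self, h2]
    · intro h
      refine ⟨fun i hi => ?_, ?_⟩
      · have := h i (Nat.lt_succ_of_lt hi); rwa [Function.update_of_ne (Fin.ne_of_lt hi)] at this
      · have := h j (Nat.lt_succ_self _); rwa [Function.update_self] at this
  · congr 1
    ext z
    simp only [mem_filter, mem_univ, true_and, AgreeBelow, Bool.not_eq_false]
    constructor
    · rintro ⟨h1, h2⟩ i hi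
      rcases Nat.lt_succ_iff_lt_or_eq.1 hi with hi | hi
      · rw [Function.update_of_ne (Fin.ne_of_lt hi), h1 i hi]
      · have : i = j := Fin.ext hi
        subst this; rw [Function.update_self, h2]
    · intro h
      refine ⟨fun i hi => ?_, ?_⟩
      · have := h i (Nat.lt_succ_of_lt hi); rwa [Function.update_of_ne (Fin.ne_of_lt hi)] at this
      · have := h j (Nat.lt_succ_self _); rwa [Function.update_self] at this

/-- Each half is at most the whole. [folklore] -/
theorem prefW_update_le (hw : ∀ y, 0 ≤ w y) (j : Fin ℓ) (y : Fin ℓ → Bool) (b : Bool) :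
    prefW w (j + 1) (Function.update y j b) ≤ prefW w j y := by
  rw [prefW_succ w j y]
  have h0 := prefW_nonneg w hw (j + 1) (Function.update y j false)
  have h1 := prefW_nonneg w hw (j + 1) (Function.update y j true)
  cases b
  · linarith
  · linarith

end Prefix

/-! ### The rotation blocks -/

section Blocks

variable (w : (Fin ℓ → Bool) → ℝ)

/-- The cosine of the Grover–Rudolph angle at level `j` for the prefix of `y`: `√(p(b0)/p(b))`. [cite: GroverRudolph2002, eq. (4)] -/
def cosGR (j : Fin ℓ) (y : Fin ℓ → Bool) : ℝ :=
  Real.sqrt (prefW w (j + 1) (Function.update y j false) / prefW w j y)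

/-- The sine of the Grover–Rudolph angle: `√(p(b1)/p(b))`. [cite: GroverRudolph2002, eq. (4)] -/
def sinGR (j : Fin ℓ) (y : Fin ℓ → Bool) : ℝ :=
  Real.sqrt (prefW w (j + 1) (Function.update y j true) / prefW w j y)

/-- `cos² + sin² = 1` on prefixes of positive mass. [cite: GroverRudolph2002, eq. (4)] -/
theorem cosGR_sq_add_sinGR_sq (hw : ∀ y, 0 ≤ w y) (j : Fin ℓ) (y : Fin ℓ → Bool) (hpos : 0 < prefW w j y) :
    cosGR w j y ^ 2 + sinGR w j y ^ 2 = 1 := by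
  unfold cosGR sinGR
  rw [Real.sq_sqrt (div_nonneg (prefW_nonneg w hw _ _) hpos.le), Real.sq_sqrt (div_nonneg (prefW_nonneg w hw _ _) hpos.le),
    ← add_div, ← prefW_succ, div_self hpos.ne']

/-- **The rotation block** at level `j` for the prefix of `y`: the real rotation taking `|0⟩` to
`cos θ |0⟩ + sin θ |1⟩` (identity on a massless prefix). Rows are output bits, columns input bits.
[cite: GroverRudolph2002, eq. (4)] -/
def rotBlock (j : Fin ℓ) (y : Fin ℓ → Bool) : Matrix (QReg 1) (QReg 1) ℂ :=
  if prefW w j y = 0 then 1 else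
    Matrix.of fun a b : QReg 1 =>
      if b 0 = false then (if a 0 = false then (cosGR w j y : ℂ) else (sinGR w j y : ℂ))
      else (if a 0 = false then -(sinGR w j y : ℂ) else (cosGR w j y : ℂ))

/-- The block depends only on the prefix below `j`. [folklore] -/
theorem rotBlock_congr {j : Fin ℓ} {y y' : Fin ℓ → Bool} (h : AgreeBelow j y y') : rotBlock w j y' = rotBlock w j y := by
  have hp : prefW w j y' = prefW w j y := prefW_congr w h
  have hu : ∀ b, AgreeBelow (j + 1) (Function.update y j b) (Function.update y' j b) := by
    intro b i hi
    rcases Nat.lt_succ_iff_lt_or_eq.1 hi with hi | hi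
    · rw [Function.update_of_ne (Fin.ne_of_lt hi), Function.update_of_ne (Fin.ne_of_lt hi), h i hi]
    · have : i = j := Fin.ext hi
      subst this; rw [Function.update_self, Function.update_self]
  have hc : cosGR w j y' = cosGR w j y := by unfold cosGR; rw [hp, prefW_congr w (hu false)]
  have hs : sinGR w j y' = sinGR w j y := by unfold sinGR; rw [hp, prefW_congr w (hu true)]
  unfold rotBlock
  rw [hp, hc, hs]

/-- In particular the block does not depend on the bit at level `j`. [folklore] -/
theorem rotBlock_update (j : Fin ℓ) (y : Fin ℓ → Bool) (b : Bool) : rotBlock w j (Function.update y j b) = rotBlock w j y :=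
  rotBlock_congr w fun i hi => by rw [Function.update_of_ne (Fin.ne_of_lt hi)]

/-- A one-qubit label is determined by its bit. [folklore] -/
theorem qreg_one_ext {a b : QReg 1} (h : a 0 = b 0) : a = b := by
  funext i; rw [Subsingleton.elim i 0]; exact h

/-- **The rotation block is unitary** (a real rotation, `cos² + sin² = 1`). [cite: GroverRudolph2002, eq. (4)] -/
theorem rotBlock_mem_unitaryGroup (hw : ∀ y, 0 ≤ w y) (j : Fin ℓ) (y : Fin ℓ → Bool) :
    rotBlock w j y ∈ Matrix.unitaryGroup (QReg 1) ℂ := by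
  unfold rotBlock
  split_ifs with h0
  · exact Submonoid.one_mem _
  · have hpos : 0 < prefW w j y := lt_of_le_of_ne (prefW_nonneg w hw _ _) (Ne.symm h0)
    have key := cosGR_sq_add_sinGR_sq w hw j y hpos
    set c : ℝ := cosGR w j y
    set s : ℝ := sinGR w j y
    rw [Matrix.mem_unitaryGroup_iff]
    ext a b
    simp only [Matrix.mul_apply, Matrix.star_apply, Matrix.of_apply, Matrix.one_apply, RCLike.star_def]
    rw [Fintype.sum_eq_add (fun _ => false) (fun _ => true) (by intro e; have := congrFun e 0; simp at this)
      (by intro x hx; exfalso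
          cases hx0 : x 0
          · exact hx.1 (qreg_one_ext hx0)
          · exact hx.2 (qreg_one_ext hx0))]
    have keyC : (c : ℂ) * c + (s : ℂ) * s = 1 := by
      have := congrArg (fun r : ℝ => (r : ℂ)) key; push_cast at this; linear_combination this
    by_cases hab : a = b
    · subst hab
      rw [if_pos rfl]
      cases ha : a 0 <;> simp [Complex.conj_ofReal] <;> linear_combination keyC
    · rw [if_neg hab]
      have hne : a 0 ≠ b 0 := fun e => hab (qreg_one_ext e)
      cases ha : a 0 <;> cases hb : b 0 <;> simp_all [Complex.conj_ofReal] <;> ring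

end Blocks

/-! ### The level gates on the register -/

section Level

variable (w : (Fin ℓ → Bool) → ℝ) (ws : Fin ℓ ↪ Fin N)

/-- **The level-`j` gate**: the rotation block of the prefix read off the wires `ws`, acting on the
wire `ws j`. [cite: GroverRudolph2002, eq. (4)] [cite: NielsenChuang2010, §4.3] -/
def levelGate (j : Fin ℓ) : Matrix (QReg N) (QReg N) ℂ := ctrlGate (ws j) fun z => rotBlock w j (z ∘ ws)

/-- Rewriting the wire `ws j` does not change the block (it reads only the prefix). [folklore] -/
theorem rotBlock_comp_update (j : Fin ℓ) (z : QReg N) (b : Bool) :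
    rotBlock w j (Function.update z (ws j) b ∘ ws) = rotBlock w j (z ∘ ws) := by
  have : Function.update z (ws j) b ∘ ws = Function.update (z ∘ ws) j b := by
    funext i
    simp only [Function.comp_apply]
    by_cases hi : i = j
    · subst hi; simp
    · rw [Function.update_of_ne (fun e => hi (ws.injective e)), Function.update_of_ne hi, Function.comp_apply]
  rw [this, rotBlock_update]

/-- **The level gate is unitary.** [folklore] -/
theorem levelGate_mem_unitaryGroup (hw : ∀ y, 0 ≤ w y) (j : Fin ℓ) :
    levelGate w ws j ∈ Matrix.unitaryGroup (QReg N) ℂ :=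
  ctrlGate_mem_unitaryGroup _ (fun z => rotBlock_mem_unitaryGroup w hw j (z ∘ ws)) (fun z b => rotBlock_comp_update w ws j z b)

/-- A label-controlled gate on wire `t` preserves every support condition closed under rewriting `t`. [folklore] -/
theorem preservesSupp_ctrlGate {P : Set (QReg N)} {t : Fin N} (hP : ∀ x b, Function.update x t b ∈ P ↔ x ∈ P)
    (U : QReg N → Matrix (QReg 1) (QReg 1) ℂ) : PreservesSupp P (ctrlGate t U) := by
  intro ψ hψ x hx
  rw [Matrix.mulVec, dotProduct]
  refine sum_eq_zero fun z _ => ?_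
  rw [ctrlGate_apply]
  split_ifs with h
  · have hz : z ∉ P := by
      intro hz
      apply hx
      have : x = Function.update z t (x t) := by
        rw [eqOff_singleton_iff] at h
        rw [h]; simp
      rw [this]; exact (hP z (x t)).2 hz
    rw [hψ z hz, mul_zero]
  · rw [zero_mul]

/-- The level gate preserves every support condition closed under rewriting the wire `ws j`. [folklore] -/
theorem preservesSupp_levelGate {P : Set (QReg N)} (j : Fin ℓ) (hP : ∀ x b, Function.update x (ws j) b ∈ P ↔ x ∈ P) :
    PreservesSupp P (levelGate w ws j) :=
  preservesSupp_ctrlGate hP _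

/-- **Writing leaf bits into the register**: `x[ws ↦ y]` (Mathlib's `Function.extend` along the
embedding). [folklore] -/
def writeY (x : QReg N) (y : Fin ℓ → Bool) : QReg N := Function.extend ws y x

/-- On the wires: `x[ws ↦ y] (ws i) = y i`. [folklore] -/
@[simp] theorem writeY_apply_ws (x : QReg N) (y : Fin ℓ → Bool) (i : Fin ℓ) : writeY ws x y (ws i) = y i :=
  ws.injective.extend_apply _ _ _

/-- Off the wires: `x[ws ↦ y] q = x q`. [folklore] -/
theorem writeY_apply_of_not_mem (x : QReg N) (y : Fin ℓ → Bool) {q : Fin N} (hq : q ∉ Set.range ws) :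
    writeY ws x y q = x q :=
  Function.extend_apply' _ _ _ (by rintro ⟨i, rfl⟩; exact hq ⟨i, rfl⟩)

/-- Reading back: `x[ws ↦ y] ∘ ws = y`. [folklore] -/
@[simp] theorem writeY_comp (x : QReg N) (y : Fin ℓ → Bool) : writeY ws x y ∘ ws = y := by
  funext i; simp

/-- Updating a written wire updates the leaf bit. [folklore] -/
theorem update_writeY (x : QReg N) (y : Fin ℓ → Bool) (j : Fin ℓ) (b : Bool) :
    Function.update (writeY ws x y) (ws j) b = writeY ws x (Function.update y j b) := by
  funext q
  by_cases hq : q = ws j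
  · subst hq; simp
  · rw [Function.update_of_ne hq]
    by_cases hr : q ∈ Set.range ws
    · obtain ⟨i, rfl⟩ := hr
      have hij : i ≠ j := fun e => hq (by rw [e])
      rw [writeY_apply_ws, writeY_apply_ws, Function.update_of_ne hij]
    · rw [writeY_apply_of_not_mem ws x y hr, writeY_apply_of_not_mem ws x _ hr]

/-- `writeY` is injective in the leaf label. [folklore] -/
theorem writeY_injective (x : QReg N) : Function.Injective (writeY ws x) := fun y y' h => by
  have := congrArg (· ∘ ws) h
  simpa using this

/-- Writing the bits the input already has changes nothing. [folklore] -/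
theorem writeY_self (x : QReg N) : writeY ws x (x ∘ ws) = x := by
  funext q
  by_cases hr : q ∈ Set.range ws
  · obtain ⟨i, rfl⟩ := hr; simp
  · exact writeY_apply_of_not_mem ws x _ hr

end Level

/-! ### The ideal evolution -/

section Ideal

variable (w : (Fin ℓ → Bool) → ℝ) (ws : Fin ℓ ↪ Fin N)

/-- Leaf labels clean from level `j` on. [folklore] -/
def cleanFrom (j : ℕ) : Finset (Fin ℓ → Bool) := univ.filter fun y => ∀ i : Fin ℓ, j ≤ (i : ℕ) → y i = false

/-- Membership in `cleanFrom`. [folklore] -/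
@[simp] theorem mem_cleanFrom {j : ℕ} {y : Fin ℓ → Bool} : y ∈ cleanFrom j ↔ ∀ i : Fin ℓ, j ≤ (i : ℕ) → y i = false := by
  simp [cleanFrom]

/-- **The state after `j` levels** on the basis input `x`:
`Σ_{y clean from j on} √(prefW j y / W) • |x[ws ↦ y]⟩`. [cite: GroverRudolph2002, eq. (5)] -/
def stateAt (x : QReg N) (j : ℕ) : QReg N → ℂ :=
  ∑ y ∈ cleanFrom j, ((Real.sqrt (prefW w j y / total w) : ℝ) : ℂ) • basisState (writeY ws x y)

/-- **The qsample** of the normalised weight: `Σ_y √(w y / W) • |x[ws ↦ y]⟩`. [cite: GroverRudolph2002, eq. (1)] -/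
def qsample (x : QReg N) : QReg N → ℂ :=
  ∑ y, ((Real.sqrt (w y / total w) : ℝ) : ℂ) • basisState (writeY ws x y)

/-- At level `0`, on an input clean on the wires, the state is the input basis state. [folklore] -/
theorem stateAt_zero (x : QReg N) (hx : ∀ i, x (ws i) = false) (hW : 0 < total w) : stateAt w ws x 0 = basisState x := by
  unfold stateAt
  have h0 : cleanFrom (ℓ := ℓ) 0 = {fun _ => false} := by
    ext y; simp only [mem_cleanFrom, zero_le, forall_const, mem_singleton]
    constructor
    · intro h; funext i; exact h i
    · rintro rfl i; rfl
  rw [h0, sum_singleton, prefW_zero, div_self hW.ne', Real.sqrt_one]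
  have : writeY ws x (fun _ => false) = x := by
    rw [show (fun _ : Fin ℓ => false) = x ∘ ws from funext fun i => (hx i).symm, writeY_self]
  rw [this]; simp

/-- From level `ℓ` on the state is the qsample. [folklore] -/
theorem stateAt_of_le {j : ℕ} (hj : ℓ ≤ j) (x : QReg N) : stateAt w ws x j = qsample w ws x := by
  unfold stateAt qsample
  have hall : cleanFrom (ℓ := ℓ) j = univ := by
    ext y; simp only [mem_cleanFrom, mem_univ, iff_true]
    intro i hi; exact absurd (lt_of_lt_of_le i.2 (hj.trans hi)) (lt_irrefl _)
  rw [hall]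
  exact sum_congr rfl fun y _ => by rw [prefW_of_le w hj]

/-- A label-controlled gate on a basis state whose controlled wire reads `0`. [cite: NielsenChuang2010, §4.3] -/
theorem ctrlGate_mulVec_basisState_false (t : Fin N) (U : QReg N → Matrix (QReg 1) (QReg 1) ℂ) (z : QReg N)
    (hz : z t = false) :
    ctrlGate t U *ᵥ basisState z =
      U z (fun _ => false) (fun _ => false) • basisState z + U z (fun _ => true) (fun _ => false) • basisState (Function.update z t true) := by
  ext x
  rw [mulVec_basisState]
  dsimp only
  rw [ctrlGate_apply]
  simp only [Pi.add_apply, Pi.smul_apply, basisState_apply, smul_eq_mul, mul_ite, mul_one, mul_zero]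
  by_cases h : EqOff [t] z x
  · rw [if_pos h, hz]
    have hx : x = Function.update z t (x t) := by rw [eqOff_singleton_iff.1 h]; simp
    cases hxt : x t
    · have hxz : x = z := by rw [hx, hxt, ← hz, Function.update_eq_self]
      rw [if_pos hxz, if_neg, add_zero]
      intro e; have := congrFun e t; rw [hxz, Function.update_self, hz] at this; exact Bool.false_ne_true this
    · have hxz : x = Function.update z t true := by rw [hx, hxt]
      rw [if_neg, if_pos hxz, zero_add]
      intro e; have := congrFun e t; rw [hxt, hz] at this; exact Bool.false_ne_true this.symm
  · rw [if_neg h, if_neg, if_neg, add_zero]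
    · intro e; apply h; rw [e]; exact eqOff_singleton_iff.2 (by simp [hz])
    · intro e; apply h; rw [e]; exact eqOff_singleton_iff.2 (by simp)

/-- The level-`j + 1` clean labels are the updates at `j` of the level-`j` clean labels. [folklore] -/
theorem cleanFrom_succ_eq_image (j : Fin ℓ) :
    cleanFrom (ℓ := ℓ) (j + 1) = ((cleanFrom (ℓ := ℓ) j) ×ˢ (univ : Finset Bool)).image fun p => Function.update p.1 j p.2 := by
  ext y
  simp only [mem_cleanFrom, mem_image, mem_product, mem_univ, and_true, Prod.exists]
  constructor
  · intro h
    refine ⟨Function.update y j false, y j, ?_, ?_⟩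
    · intro i hi
      by_cases hij : i = j
      · subst hij; simp
      · rw [Function.update_of_ne hij]
        exact h i (by have : (j : ℕ) ≠ i := fun e => hij (Fin.ext e.symm); omega)
    · simp
  · rintro ⟨y₀, b, hy₀, rfl⟩ i hi
    rw [Function.update_of_ne (by intro e; subst e; omega)]
    exact hy₀ i (by omega)

/-- The update map is injective on level-`j` clean labels paired with a bit. [folklore] -/
theorem update_injOn (j : Fin ℓ) :
    Set.InjOn (fun p : (Fin ℓ → Bool) × Bool => Function.update p.1 j p.2)
      (((cleanFrom (ℓ := ℓ) j) ×ˢ (univ : Finset Bool) : Finset _) : Set ((Fin ℓ → Bool) × Bool)) := by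
  rintro ⟨y, b⟩ hy ⟨y', b'⟩ hy' h
  dsimp only at h
  simp only [coe_product, coe_univ, Set.mem_prod, mem_coe, mem_cleanFrom, Set.mem_univ, and_true] at hy hy'
  have hb : b = b' := by have := congrFun h j; simpa using this
  subst hb
  have hy0 : y j = y' j := by rw [hy j le_rfl, hy' j le_rfl]
  have : y = y' := by
    funext i
    by_cases hij : i = j
    · subst hij; exact hy0
    · have := congrFun h i; rwa [Function.update_of_ne hij, Function.update_of_ne hij] at this
  rw [this]

/-- The coefficient identity of one level: `√(p(b)/W) · √(p(bβ)/p(b)) = √(p(bβ)/W)`. [cite: GroverRudolph2002, eq. (4)–(5)] -/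
theorem sqrt_mul_sqrt_div {a b W : ℝ} (ha : 0 ≤ a) (hb : 0 ≤ b) (hba : b ≤ a) (hW : 0 < W) :
    Real.sqrt (a / W) * Real.sqrt (b / a) = Real.sqrt (b / W) := by
  rcases eq_or_lt_of_le ha with h0 | hpos
  · have hb0 : b = 0 := le_antisymm (h0 ▸ hba) hb
    rw [← h0, hb0]; simp
  · rw [← Real.sqrt_mul (div_nonneg ha hW.le)]
    congr 1
    field_simp

/-- **The level step**: level `j` maps the state after `j` levels to the state after `j + 1` levels
(on any basis input `x`). [cite: GroverRudolph2002, eq. (4)–(5)] -/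
theorem levelGate_mulVec_stateAt (hw : ∀ y, 0 ≤ w y) (hW : 0 < total w) (x : QReg N) (j : Fin ℓ) :
    levelGate w ws j *ᵥ stateAt w ws x j = stateAt w ws x (j + 1) := by
  unfold stateAt levelGate
  rw [Matrix.mulVec_sum]
  -- the right-hand side as a sum over (level-`j` label, new bit)
  rw [cleanFrom_succ_eq_image, sum_image (update_injOn j), sum_product]
  refine sum_congr rfl fun y hy => ?_
  rw [mem_cleanFrom] at hy
  have hyj : y j = false := hy j le_rfl
  have hz : writeY ws x y (ws j) = false := by rw [writeY_apply_ws, hyj]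
  rw [Matrix.mulVec_smul, ctrlGate_mulVec_basisState_false _ _ _ hz, writeY_comp, update_writeY, Fintype.sum_bool,
    smul_add, smul_smul, smul_smul]
  have hupd0 : Function.update y j false = y := by rw [← hyj, Function.update_eq_self]
  -- the block entries
  have hpj := prefW_nonneg w hw j y
  by_cases h0 : prefW w j y = 0
  · -- massless prefix: everything vanishes
    have hb : ∀ b, prefW w (j + 1) (Function.update y j b) = 0 := fun b =>
      le_antisymm (h0 ▸ prefW_update_le w hw j y b) (prefW_nonneg w hw _ _)
    rw [h0, hb true, hb false, hupd0]
    simp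
  · have hpos : 0 < prefW w j y := lt_of_le_of_ne hpj (Ne.symm h0)
    have hrot : rotBlock w j y = Matrix.of fun a b : QReg 1 =>
        if b 0 = false then (if a 0 = false then (cosGR w j y : ℂ) else (sinGR w j y : ℂ))
        else (if a 0 = false then -(sinGR w j y : ℂ) else (cosGR w j y : ℂ)) := by
      unfold rotBlock; rw [if_neg h0]
    rw [hrot]
    simp only [Matrix.of_apply, ↓reduceIte, Bool.true_eq_false]
    rw [add_comm, hupd0]
    congr 1
    · congr 1
      unfold sinGR
      rw [← Complex.ofReal_mul, sqrt_mul_sqrt_div hpj (prefW_nonneg w hw _ _) (prefW_update_le w hw j y true) hW]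
    · congr 1
      unfold cosGR
      rw [← Complex.ofReal_mul, sqrt_mul_sqrt_div hpj (prefW_nonneg w hw _ _) (prefW_update_le w hw j y false) hW, hupd0]

/-- The list of level gates, last level first (the order of a matrix product applied right to left). [folklore] -/
def levelList : List (Matrix (QReg N) (QReg N) ℂ) := (List.ofFn fun j : Fin ℓ => levelGate w ws j).reverse

/-- The product of the first `k` levels maps the input to the state after `k` levels. [cite: GroverRudolph2002, eq. (5)] -/
theorem prod_take_mulVec (hw : ∀ y, 0 ≤ w y) (hW : 0 < total w) (x : QReg N) (hx : ∀ i, x (ws i) = false) :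
    ∀ k, k ≤ ℓ → ((List.ofFn fun j : Fin ℓ => levelGate w ws j).take k).reverse.prod *ᵥ basisState x = stateAt w ws x k
  | 0, _ => by simp [stateAt_zero w ws x hx hW]
  | k + 1, hk => by
    have hk' : k < ℓ := hk
    rw [List.take_add_one, List.reverse_append, List.prod_append, ← Matrix.mulVec_mulVec,
      prod_take_mulVec hw hW x hx k (Nat.le_of_lt hk')]
    rw [List.getElem?_ofFn]
    simp only [hk', ↓reduceDIte, Option.toList_some, List.reverse_singleton, List.prod_singleton]
    exact levelGate_mulVec_stateAt w ws hw hW x ⟨k, hk'⟩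

/-- **Grover–Rudolph, ideal form**: on a basis input clean on the wires `ws`, the product of the level
gates (level `0` applied first) produces the qsample `Σ_y √(w y / W) |x[ws ↦ y]⟩`.
[cite: GroverRudolph2002, eqs. (1)–(5)] [cite: Regev2009, Lemma 3.12 (proof)] -/
theorem prod_levelList_mulVec_basisState (hw : ∀ y, 0 ≤ w y) (hW : 0 < total w) (x : QReg N) (hx : ∀ i, x (ws i) = false) :
    (levelList w ws).prod *ᵥ basisState x = qsample w ws x := by
  have h := prod_take_mulVec w ws hw hW x hx ℓ le_rfl
  rw [List.take_of_length_le (by simp)] at h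
  rw [levelList, h, stateAt_of_le w ws le_rfl]

/-- **The qsample is a unit vector.** [cite: GroverRudolph2002, eq. (1)] -/
theorem normSq_qsample (hw : ∀ y, 0 ≤ w y) (hW : 0 < total w) (x : QReg N) : Cryptography.normSq (qsample w ws x) = 1 := by
  unfold Cryptography.normSq qsample
  -- expand the amplitude at each basis label
  have happ : ∀ z : QReg N, (∑ y, ((Real.sqrt (w y / total w) : ℝ) : ℂ) • basisState (writeY ws x y)) z =
      if h : z ∈ Set.range (writeY ws x) then ((Real.sqrt (w (h.choose) / total w) : ℝ) : ℂ) else 0 := by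
    intro z
    rw [Finset.sum_apply]
    simp only [Pi.smul_apply, basisState_apply, smul_eq_mul, mul_ite, mul_one, mul_zero]
    split_ifs with h
    · have hspec := h.choose_spec
      rw [Finset.sum_eq_single h.choose]
      · rw [if_pos hspec.symm]
      · intro y _ hy
        rw [if_neg]
        intro e; apply hy
        exact writeY_injective ws x (by rw [← e, hspec])
      · simp
    · exact Finset.sum_eq_zero fun y _ => if_neg fun e => h ⟨y, e.symm⟩
  simp_rw [happ]
  rw [← Finset.sum_filter_add_sum_filter_not univ (fun z => z ∈ Set.range (writeY ws x))]
  have hzero : ∑ z ∈ univ.filter (fun z => z ∉ Set.range (writeY ws x)),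
      ‖(if h : z ∈ Set.range (writeY ws x) then ((Real.sqrt (w h.choose / total w) : ℝ) : ℂ) else 0)‖ ^ 2 = 0 :=
    Finset.sum_eq_zero fun z hz => by rw [mem_filter] at hz; rw [dif_neg hz.2]; simp
  rw [hzero, add_zero]
  -- reindex the range by the leaves
  have himg : univ.filter (fun z => z ∈ Set.range (writeY ws x)) = univ.image (writeY ws x) := by
    ext z; simp [Set.mem_range, eq_comm]
  rw [himg, sum_image fun y _ y' _ h => writeY_injective ws x h]
  have hterm : ∀ y, ‖(if h : writeY ws x y ∈ Set.range (writeY ws x) then ((Real.sqrt (w h.choose / total w) : ℝ) : ℂ) else 0)‖ ^ 2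
      = w y / total w := by
    intro y
    have h : writeY ws x y ∈ Set.range (writeY ws x) := ⟨y, rfl⟩
    rw [dif_pos h]
    have hy : h.choose = y := writeY_injective ws x h.choose_spec
    rw [hy, Complex.norm_real, Real.norm_eq_abs, sq_abs, Real.sq_sqrt (div_nonneg (hw y) hW.le)]
  simp_rw [hterm]
  rw [← Finset.sum_div, div_eq_one_iff_eq hW.ne']
  rfl

/-- The qsample has `ℓ²`-norm one. [folklore] -/
theorem l2Norm_qsample (hw : ∀ y, 0 ≤ w y) (hW : 0 < total w) (x : QReg N) : l2Norm (qsample w ws x) = 1 := by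
  rw [l2Norm_eq_sqrt_normSq, normSq_qsample w ws hw hW x, Real.sqrt_one]

end Ideal

/-! ### The robust form -/

section Robust

variable (w : (Fin ℓ → Bool) → ℝ) (ws : Fin ℓ ↪ Fin N)

/-- **Grover–Rudolph with approximate level gates.** If the matrices `M j` implement the level gates on a
support condition `P` up to `δ j` (`P` closed under rewriting each wire `ws j` and containing the clean
input `x`) and are contractions, then their product (level `0` first) applied to `|x⟩` is within
`Σ_j δ j` of the qsample in `ℓ²`-norm. [cite: NielsenChuang2010, §4.5.3 eq. (4.63)] [cite: GroverRudolph2002, eqs. (1)–(5)] -/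
theorem l2Norm_prod_sub_qsample_le (hw : ∀ y, 0 ≤ w y) (hW : 0 < total w) {P : Set (QReg N)}
    (hP : ∀ (j : Fin ℓ) (x : QReg N) (b : Bool), Function.update x (ws j) b ∈ P ↔ x ∈ P)
    (M : Fin ℓ → Matrix (QReg N) (QReg N) ℂ) (δ : Fin ℓ → ℝ) (hδ : ∀ j, 0 ≤ δ j)
    (hM : ∀ j, IsContraction (M j)) (himpl : ∀ j, ImplOn P (M j) (levelGate w ws j) (δ j))
    (x : QReg N) (hxP : x ∈ P) (hx : ∀ i, x (ws i) = false) :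
    l2Norm ((List.ofFn M).reverse.prod *ᵥ basisState x - qsample w ws x) ≤ ∑ j, δ j := by
  set L : List (ApproxStep N) := (List.ofFn fun j : Fin ℓ => (⟨M j, levelGate w ws j, δ j⟩ : ApproxStep N)).reverse with hL
  have hgood : ∀ s ∈ L, s.Good P := by
    intro s hs
    rw [hL, List.mem_reverse, List.mem_ofFn] at hs
    obtain ⟨j, rfl⟩ := hs
    exact ⟨himpl j, hM j, isContraction_of_mem_unitaryGroup (levelGate_mem_unitaryGroup w ws hw j),
      preservesSupp_levelGate w ws j (hP j), hδ j⟩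
  have h := ImplOn.listProd hgood (basisState x) (suppIn_basisState hxP)
  have hact : (L.map ApproxStep.act) = (List.ofFn M).reverse := by
    rw [hL, List.map_reverse, List.map_ofFn]; rfl
  have hideal : (L.map ApproxStep.ideal) = levelList w ws := by
    rw [hL, List.map_reverse, List.map_ofFn]; rfl
  have herr : (L.map ApproxStep.err).sum = ∑ j, δ j := by
    rw [hL, List.map_reverse, List.sum_reverse, List.map_ofFn, List.sum_ofFn]; rfl
  rw [hact, hideal, herr, prod_levelList_mulVec_basisState w ws hw hW x hx] at h
  have hn : l2Norm (basisState x) = 1 := by rw [l2Norm_eq_sqrt_normSq, normSq_basisState, Real.sqrt_one]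
  rwa [hn, mul_one] at h

end Robust

/-! ### Perturbed angles: the machine's blocks versus the exact ones -/

section Perturbed

variable (w : (Fin ℓ → Bool) → ℝ) (ws : Fin ℓ ↪ Fin N)

/-- A general family of prefix-dependent one-qubit blocks placed level by level (the blocks a machine
actually realises, with rounded angles). [cite: GroverRudolph2002, eq. (4)] -/
def genLevelGate (R : Fin ℓ → (Fin ℓ → Bool) → Matrix (QReg 1) (QReg 1) ℂ) (j : Fin ℓ) : Matrix (QReg N) (QReg N) ℂ :=
  ctrlGate (ws j) fun z => R j (z ∘ ws)

/-- **A general level gate on a level-`j` superposition**: each clean label `y` is sent to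
`R₀₀ |y⟩ + R₁₀ |y[j ↦ 1]⟩`. [cite: NielsenChuang2010, §4.3] -/
theorem genLevelGate_mulVec_sum (R : Fin ℓ → (Fin ℓ → Bool) → Matrix (QReg 1) (QReg 1) ℂ) (j : Fin ℓ)
    (x : QReg N) (a : (Fin ℓ → Bool) → ℂ) :
    genLevelGate ws R j *ᵥ (∑ y ∈ cleanFrom j, a y • basisState (writeY ws x y)) =
      ∑ y ∈ cleanFrom j, (a y * R j y (fun _ => false) (fun _ => false)) • basisState (writeY ws x y) +
        ∑ y ∈ cleanFrom j, (a y * R j y (fun _ => true) (fun _ => false)) • basisState (writeY ws x (Function.update y j true)) := by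
  unfold genLevelGate
  rw [Matrix.mulVec_sum, ← sum_add_distrib]
  refine sum_congr rfl fun y hy => ?_
  rw [mem_cleanFrom] at hy
  have hz : writeY ws x y (ws j) = false := by rw [writeY_apply_ws, hy j le_rfl]
  rw [Matrix.mulVec_smul, ctrlGate_mulVec_basisState_false _ _ _ hz, writeY_comp, update_writeY, smul_add, smul_smul, smul_smul]

/-- The labels `y` and `y'[j ↦ 1]` over clean level-`j` labels are pairwise distinct basis labels, so the
squared norm of `Σ a_y |y⟩ + Σ b_y |y[j↦1]⟩` is `Σ (|a_y|² + |b_y|²)`. [cite: NielsenChuang2010, §2.1.4] -/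
theorem normSq_sum_add_sum (j : Fin ℓ) (x : QReg N) (a b : (Fin ℓ → Bool) → ℂ) :
    Cryptography.normSq (∑ y ∈ cleanFrom j, a y • basisState (writeY ws x y) +
        ∑ y ∈ cleanFrom j, b y • basisState (writeY ws x (Function.update y j true))) =
      ∑ y ∈ cleanFrom j, (‖a y‖ ^ 2 + ‖b y‖ ^ 2) := by
  -- rewrite as ONE sum over the level-`j+1` clean labels, with coefficient read off the bit `j`
  set f : (Fin ℓ → Bool) → ℂ := fun y' => if y' j = false then a y' else b (Function.update y' j false) with hf
  have hsum : (∑ y ∈ cleanFrom j, a y • basisState (writeY ws x y) +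
      ∑ y ∈ cleanFrom j, b y • basisState (writeY ws x (Function.update y j true))) =
      ∑ y' ∈ cleanFrom (ℓ := ℓ) (j + 1), f y' • basisState (writeY ws x y') := by
    rw [cleanFrom_succ_eq_image, sum_image (update_injOn j), sum_product]
    rw [← sum_add_distrib]
    refine sum_congr rfl fun y hy => ?_
    rw [mem_cleanFrom] at hy
    have hyj : y j = false := hy j le_rfl
    rw [Fintype.sum_bool, hf]
    simp only [Function.update_self, Bool.true_eq_false, ↓reduceIte, Function.update_idem]
    rw [show Function.update y j false = y by rw [← hyj, Function.update_eq_self], add_comm]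
  rw [hsum]
  -- orthonormality of distinct basis states
  have horth : Cryptography.normSq (∑ y' ∈ cleanFrom (ℓ := ℓ) (j + 1), f y' • basisState (writeY ws x y')) =
      ∑ y' ∈ cleanFrom (ℓ := ℓ) (j + 1), ‖f y'‖ ^ 2 := by
    unfold Cryptography.normSq
    set S := cleanFrom (ℓ := ℓ) (j + 1) with hS
    have happ : ∀ z : QReg N, (∑ y' ∈ S, f y' • basisState (writeY ws x y')) z =
        ∑ y' ∈ S, if z = writeY ws x y' then f y' else 0 := by
      intro z
      rw [Finset.sum_apply]
      refine sum_congr rfl fun y' _ => ?_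
      simp [basisState_apply]
    simp_rw [happ]
    -- each `z` picks at most one `y'`
    have hone : ∀ z : QReg N, (∑ y' ∈ S, if z = writeY ws x y' then f y' else 0) =
        if h : z ∈ S.image (writeY ws x) then f (Finset.mem_image.1 h).choose else 0 := by
      intro z
      split_ifs with h
      · obtain ⟨hmem, hz⟩ := (Finset.mem_image.1 h).choose_spec
        rw [Finset.sum_eq_single (Finset.mem_image.1 h).choose]
        · rw [if_pos hz.symm]
        · intro y' _ hy'
          rw [if_neg]
          intro e; apply hy'
          exact writeY_injective ws x (by rw [← e, hz])
        · intro hn; exact absurd hmem hn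
      · exact Finset.sum_eq_zero fun y' hy' => if_neg fun e => h (Finset.mem_image.2 ⟨y', hy', e.symm⟩)
    simp_rw [hone]
    rw [← Finset.sum_filter_add_sum_filter_not univ (fun z => z ∈ S.image (writeY ws x))]
    have hzero : ∑ z ∈ univ.filter (fun z => z ∉ S.image (writeY ws x)),
        ‖(if h : z ∈ S.image (writeY ws x) then f (Finset.mem_image.1 h).choose else 0)‖ ^ 2 = 0 :=
      Finset.sum_eq_zero fun z hz => by rw [mem_filter] at hz; rw [dif_neg hz.2]; simp
    rw [hzero, add_zero]
    have himg : univ.filter (fun z => z ∈ S.image (writeY ws x)) = S.image (writeY ws x) := by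
      ext z; simp
    rw [himg, sum_image fun y _ y' _ h => writeY_injective ws x h]
    refine sum_congr rfl fun y' hy' => ?_
    have h : writeY ws x y' ∈ S.image (writeY ws x) := Finset.mem_image.2 ⟨y', hy', rfl⟩
    rw [dif_pos h]
    have : (Finset.mem_image.1 h).choose = y' := writeY_injective ws x (Finset.mem_image.1 h).choose_spec.2
    rw [this]
  rw [horth, cleanFrom_succ_eq_image, sum_image (update_injOn j), sum_product]
  refine sum_congr rfl fun y hy => ?_
  rw [mem_cleanFrom] at hy
  have hyj : y j = false := hy j le_rfl
  rw [Fintype.sum_bool, hf]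
  simp only [Function.update_self, Bool.true_eq_false, ↓reduceIte, Function.update_idem]
  rw [show Function.update y j false = y by rw [← hyj, Function.update_eq_self], add_comm]

/-- **One perturbed level on the level-`j` state**: the squared deviation of a general level gate from
the exact one on `stateAt j` is the `p(b)/W`-weighted sum of the squared entry deviations of the blocks
in their first column. [cite: NielsenChuang2010, §4.5.3] -/
theorem normSq_genLevelGate_sub_levelGate_stateAt (hw : ∀ y, 0 ≤ w y) (hW : 0 < total w)
    (R : Fin ℓ → (Fin ℓ → Bool) → Matrix (QReg 1) (QReg 1) ℂ) (x : QReg N) (j : Fin ℓ) :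
    Cryptography.normSq (genLevelGate ws R j *ᵥ stateAt w ws x j - levelGate w ws j *ᵥ stateAt w ws x j) =
      ∑ y ∈ cleanFrom j, prefW w j y / total w *
        (‖R j y (fun _ => false) (fun _ => false) - rotBlock w j y (fun _ => false) (fun _ => false)‖ ^ 2 +
          ‖R j y (fun _ => true) (fun _ => false) - rotBlock w j y (fun _ => true) (fun _ => false)‖ ^ 2) := by
  have hlevel : levelGate w ws j = genLevelGate ws (fun j y => rotBlock w j y) j := rfl
  unfold stateAt
  rw [hlevel, genLevelGate_mulVec_sum, genLevelGate_mulVec_sum]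
  have hre : ∀ (a b c d : QReg N → ℂ), (a + b) - (c + d) = (a - c) + (b - d) := fun a b c d => by abel
  rw [hre, ← sum_sub_distrib, ← sum_sub_distrib]
  simp_rw [← sub_smul, ← mul_sub]
  rw [normSq_sum_add_sum]
  refine sum_congr rfl fun y _ => ?_
  have hp : 0 ≤ prefW w j y / total w := div_nonneg (prefW_nonneg w hw _ _) hW.le
  rw [norm_mul, norm_mul, Complex.norm_real, Real.norm_eq_abs, abs_of_nonneg (Real.sqrt_nonneg _), mul_pow, mul_pow,
    Real.sq_sqrt hp]
  ring

/-- **The level-`j` prefixes partition the mass**: `Σ_{y clean from j} prefW j y = W`. [cite: GroverRudolph2002, eq. (3)] -/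
theorem sum_cleanFrom_prefW (j : ℕ) : ∑ y ∈ cleanFrom (ℓ := ℓ) j, prefW w j y = total w := by
  classical
  unfold prefW total
  -- truncation of a label to its prefix
  set tr : (Fin ℓ → Bool) → (Fin ℓ → Bool) := fun y' i => if (i : ℕ) < j then y' i else false with htr
  have htrC : ∀ y', tr y' ∈ cleanFrom (ℓ := ℓ) j := fun y' => by
    rw [mem_cleanFrom]; intro i hi; rw [htr]; dsimp only; rw [if_neg (by omega)]
  have hfib : ∀ y ∈ cleanFrom (ℓ := ℓ) j, ∀ y', AgreeBelow j y y' ↔ tr y' = y := by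
    intro y hy y'
    rw [mem_cleanFrom] at hy
    constructor
    · intro h; funext i
      rw [htr]; dsimp only
      split_ifs with hi
      · exact h i hi
      · exact (hy i (by omega)).symm
    · intro h i hi
      rw [← h, htr]; dsimp only; rw [if_pos hi]
  rw [Finset.sum_comm' (t' := univ) (s' := fun y' => {tr y'})
    (fun y y' => by
      simp only [mem_filter, mem_univ, true_and, mem_singleton]
      constructor
      · rintro ⟨hy, ha⟩; exact ⟨((hfib y hy y').1 ha).symm, trivial⟩
      · rintro ⟨rfl, -⟩; exact ⟨htrC y', (hfib _ (htrC y') y').2 rfl⟩)]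
  simp

/-- The weighted deviation of one level is small when the good labels are `ε`-accurate and the bad ones
carry mass `≤ β`. [cite: NielsenChuang2010, §4.5.3] -/
theorem weighted_deviation_le (hw : ∀ y, 0 ≤ w y) (hW : 0 < total w)
    (R : Fin ℓ → (Fin ℓ → Bool) → Matrix (QReg 1) (QReg 1) ℂ) (hRu : ∀ j y, R j y ∈ Matrix.unitaryGroup (QReg 1) ℂ)
    (good : Fin ℓ → (Fin ℓ → Bool) → Prop) [∀ j y, Decidable (good j y)] {ε β : ℝ}
    (hgood : ∀ j y, good j y →
      ‖R j y (fun _ => false) (fun _ => false) - rotBlock w j y (fun _ => false) (fun _ => false)‖ ≤ ε ∧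
        ‖R j y (fun _ => true) (fun _ => false) - rotBlock w j y (fun _ => true) (fun _ => false)‖ ≤ ε)
    (hbad : ∀ j : Fin ℓ, ∑ y ∈ (cleanFrom (ℓ := ℓ) j).filter (fun y => ¬ good j y), prefW w j y / total w ≤ β)
    (j : Fin ℓ) :
    ∑ y ∈ cleanFrom j, prefW w j y / total w *
        (‖R j y (fun _ => false) (fun _ => false) - rotBlock w j y (fun _ => false) (fun _ => false)‖ ^ 2 +
          ‖R j y (fun _ => true) (fun _ => false) - rotBlock w j y (fun _ => true) (fun _ => false)‖ ^ 2) ≤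
      2 * ε ^ 2 + 8 * β := by
  set d : (Fin ℓ → Bool) → ℝ := fun y =>
    ‖R j y (fun _ => false) (fun _ => false) - rotBlock w j y (fun _ => false) (fun _ => false)‖ ^ 2 +
      ‖R j y (fun _ => true) (fun _ => false) - rotBlock w j y (fun _ => true) (fun _ => false)‖ ^ 2 with hd
  have hp : ∀ y, 0 ≤ prefW w j y / total w := fun y => div_nonneg (prefW_nonneg w hw _ _) hW.le
  -- entries of unitaries have modulus at most one, so every deviation is at most `8`
  have hent : ∀ (M : Matrix (QReg 1) (QReg 1) ℂ), M ∈ Matrix.unitaryGroup (QReg 1) ℂ → ∀ a b, ‖M a b‖ ≤ 1 :=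
    fun M hM a b => entry_norm_bound_of_unitary hM a b
  have hd8 : ∀ y, d y ≤ 8 := by
    intro y
    have e1 := hent _ (hRu j y) (fun _ => false) (fun _ => false)
    have e2 := hent _ (rotBlock_mem_unitaryGroup w hw j y) (fun _ => false) (fun _ => false)
    have e3 := hent _ (hRu j y) (fun _ => true) (fun _ => false)
    have e4 := hent _ (rotBlock_mem_unitaryGroup w hw j y) (fun _ => true) (fun _ => false)
    have h1 : ‖R j y (fun _ => false) (fun _ => false) - rotBlock w j y (fun _ => false) (fun _ => false)‖ ≤ 2 :=
      (norm_sub_le _ _).trans (by linarith)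
    have h2 : ‖R j y (fun _ => true) (fun _ => false) - rotBlock w j y (fun _ => true) (fun _ => false)‖ ≤ 2 :=
      (norm_sub_le _ _).trans (by linarith)
    have h1' := pow_le_pow_left₀ (norm_nonneg _) h1 2
    have h2' := pow_le_pow_left₀ (norm_nonneg _) h2 2
    rw [hd]; dsimp only; linarith
  have hd2 : ∀ y, good j y → d y ≤ 2 * ε ^ 2 := by
    intro y hy
    obtain ⟨h1, h2⟩ := hgood j y hy
    have h1' := pow_le_pow_left₀ (norm_nonneg _) h1 2
    have h2' := pow_le_pow_left₀ (norm_nonneg _) h2 2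
    rw [hd]; dsimp only; linarith
  have hsum1 : ∑ y ∈ cleanFrom j, prefW w j y / total w = 1 := by
    rw [← Finset.sum_div, sum_cleanFrom_prefW, div_self hW.ne']
  rw [← Finset.sum_filter_add_sum_filter_not (cleanFrom j) (fun y => good j y)]
  have hG : ∑ y ∈ (cleanFrom j).filter (fun y => good j y), prefW w j y / total w * d y ≤ 2 * ε ^ 2 := by
    calc ∑ y ∈ (cleanFrom j).filter (fun y => good j y), prefW w j y / total w * d y
        ≤ ∑ y ∈ (cleanFrom j).filter (fun y => good j y), prefW w j y / total w * (2 * ε ^ 2) :=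
          sum_le_sum fun y hy => mul_le_mul_of_nonneg_left (hd2 y (mem_filter.1 hy).2) (hp y)
      _ = (∑ y ∈ (cleanFrom j).filter (fun y => good j y), prefW w j y / total w) * (2 * ε ^ 2) := by rw [sum_mul]
      _ ≤ 1 * (2 * ε ^ 2) := by
          gcongr
          rw [← hsum1]
          exact sum_le_sum_of_subset_of_nonneg (filter_subset _ _) fun y _ _ => hp y
      _ = 2 * ε ^ 2 := one_mul _
  have hB : ∑ y ∈ (cleanFrom j).filter (fun y => ¬ good j y), prefW w j y / total w * d y ≤ 8 * β := by
    calc ∑ y ∈ (cleanFrom j).filter (fun y => ¬ good j y), prefW w j y / total w * d y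
        ≤ ∑ y ∈ (cleanFrom j).filter (fun y => ¬ good j y), prefW w j y / total w * 8 :=
          sum_le_sum fun y _ => mul_le_mul_of_nonneg_left (hd8 y) (hp y)
      _ = (∑ y ∈ (cleanFrom j).filter (fun y => ¬ good j y), prefW w j y / total w) * 8 := by rw [sum_mul]
      _ ≤ β * 8 := by gcongr; exact hbad j
      _ = 8 * β := by ring
  linarith

/-- A general level gate with unitary, bit-`j`-independent blocks is unitary. [folklore] -/
theorem genLevelGate_mem_unitaryGroup (R : Fin ℓ → (Fin ℓ → Bool) → Matrix (QReg 1) (QReg 1) ℂ)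
    (hRu : ∀ j y, R j y ∈ Matrix.unitaryGroup (QReg 1) ℂ) (hRind : ∀ j y b, R j (Function.update y j b) = R j y)
    (j : Fin ℓ) : genLevelGate ws R j ∈ Matrix.unitaryGroup (QReg N) ℂ := by
  refine ctrlGate_mem_unitaryGroup _ (fun z => hRu j (z ∘ ws)) (fun z b => ?_)
  have : Function.update z (ws j) b ∘ ws = Function.update (z ∘ ws) j b := by
    funext i
    simp only [Function.comp_apply]
    by_cases hi : i = j
    · subst hi; simp
    · rw [Function.update_of_ne (fun e => hi (ws.injective e)), Function.update_of_ne hi, Function.comp_apply]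
  show R j (Function.update z (ws j) b ∘ ws) = R j (z ∘ ws)
  rw [this, hRind]

/-- **Grover–Rudolph with perturbed blocks.** Let `R j y` be the prefix-dependent blocks a machine
realises (unitary, independent of the bits from `j` on as the exact ones are). Call a clean level-`j`
label *good* when the first column of `R j y` is within `ε` of that of the exact rotation `rotBlock w j y`
in each entry, and suppose the other clean level-`j` labels carry normalised mass `≤ β` at every level.
Then the product of the perturbed levels applied to the clean input `|x⟩` is within
`ℓ · √(2ε² + 8β)` of the qsample. (The machines make `ε` dyadically small by computing the angles to
enough bits on the prefixes of non-negligible mass, and `β` is the Gaussian mass outside the core.)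
[cite: GroverRudolph2002, eqs. (1)–(5)] [cite: NielsenChuang2010, §4.5.3 eq. (4.63)] -/
theorem l2Norm_prod_genLevelGate_sub_qsample_le (hw : ∀ y, 0 ≤ w y) (hW : 0 < total w)
    (R : Fin ℓ → (Fin ℓ → Bool) → Matrix (QReg 1) (QReg 1) ℂ)
    (hRu : ∀ j y, R j y ∈ Matrix.unitaryGroup (QReg 1) ℂ)
    (hRind : ∀ j y b, R j (Function.update y j b) = R j y)
    (good : Fin ℓ → (Fin ℓ → Bool) → Prop) [∀ j y, Decidable (good j y)] {ε β : ℝ}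
    (hgood : ∀ j y, good j y →
      ‖R j y (fun _ => false) (fun _ => false) - rotBlock w j y (fun _ => false) (fun _ => false)‖ ≤ ε ∧
        ‖R j y (fun _ => true) (fun _ => false) - rotBlock w j y (fun _ => true) (fun _ => false)‖ ≤ ε)
    (hbad : ∀ j : Fin ℓ, ∑ y ∈ (cleanFrom (ℓ := ℓ) j).filter (fun y => ¬ good j y), prefW w j y / total w ≤ β)
    (x : QReg N) (hx : ∀ i, x (ws i) = false) :
    l2Norm ((List.ofFn fun j => genLevelGate ws R j).reverse.prod *ᵥ basisState x - qsample w ws x) ≤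
      ℓ * Real.sqrt (2 * ε ^ 2 + 8 * β) := by
  set r : ℝ := Real.sqrt (2 * ε ^ 2 + 8 * β) with hr
  have hr0 : 0 ≤ r := Real.sqrt_nonneg _
  -- one level on the ideal state
  have hstep : ∀ j : Fin ℓ, l2Norm (genLevelGate ws R j *ᵥ stateAt w ws x j - levelGate w ws j *ᵥ stateAt w ws x j) ≤ r := by
    intro j
    rw [l2Norm_eq_sqrt_normSq, normSq_genLevelGate_sub_levelGate_stateAt w ws hw hW R x j, hr]
    exact Real.sqrt_le_sqrt (weighted_deviation_le w hw hW R hRu good hgood hbad j)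
  -- induction along the levels
  have key : ∀ k, k ≤ ℓ →
      l2Norm (((List.ofFn fun j : Fin ℓ => genLevelGate ws R j).take k).reverse.prod *ᵥ basisState x - stateAt w ws x k) ≤ k * r := by
    intro k
    induction k with
    | zero => intro _; simp [stateAt_zero w ws x hx hW, l2Norm_eq_sqrt_normSq, Cryptography.normSq]
    | succ k ih =>
      intro hk
      have hk' : k < ℓ := hk
      have ih' := ih (Nat.le_of_lt hk')
      rw [List.take_add_one, List.reverse_append, List.prod_append, ← Matrix.mulVec_mulVec, List.getElem?_ofFn]
      simp only [hk', ↓reduceDIte, Option.toList_some, List.reverse_singleton, List.prod_singleton]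
      set A := ((List.ofFn fun j : Fin ℓ => genLevelGate ws R j).take k).reverse.prod *ᵥ basisState x
      have hU := levelGate_mulVec_stateAt w ws hw hW x ⟨k, hk'⟩
      rw [show ((k : ℕ) + 1 : ℕ) = (⟨k, hk'⟩ : Fin ℓ) + 1 from rfl, ← hU]
      have hVc : IsContraction (genLevelGate ws R ⟨k, hk'⟩) :=
        isContraction_of_mem_unitaryGroup (genLevelGate_mem_unitaryGroup ws R hRu hRind ⟨k, hk'⟩)
      calc l2Norm (genLevelGate ws R ⟨k, hk'⟩ *ᵥ A - levelGate w ws ⟨k, hk'⟩ *ᵥ stateAt w ws x k)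
          = l2Norm ((genLevelGate ws R ⟨k, hk'⟩ *ᵥ A - genLevelGate ws R ⟨k, hk'⟩ *ᵥ stateAt w ws x k) +
              (genLevelGate ws R ⟨k, hk'⟩ *ᵥ stateAt w ws x k - levelGate w ws ⟨k, hk'⟩ *ᵥ stateAt w ws x k)) := by
            congr 1; abel
        _ ≤ l2Norm (genLevelGate ws R ⟨k, hk'⟩ *ᵥ A - genLevelGate ws R ⟨k, hk'⟩ *ᵥ stateAt w ws x k) +
              l2Norm (genLevelGate ws R ⟨k, hk'⟩ *ᵥ stateAt w ws x k - levelGate w ws ⟨k, hk'⟩ *ᵥ stateAt w ws x k) :=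
            l2Norm_add_le _ _
        _ ≤ l2Norm (A - stateAt w ws x k) + r := by
            gcongr
            · rw [← Matrix.mulVec_sub]; exact hVc _
            · exact hstep ⟨k, hk'⟩
        _ ≤ k * r + r := by gcongr
        _ = ((k + 1 : ℕ) : ℝ) * r := by push_cast; ring
  have h := key ℓ le_rfl
  rwa [List.take_of_length_le (by simp), stateAt_of_le w ws le_rfl] at h

end Perturbed

end GroverRudolph

end Literature.Computability.QuantumComplexity

end
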